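import Summits.Parity.BatemanHorn.Theorems.AlmostPrimeZerosSystemLSDRealSegmentNairMain
import Summits.Parity.BatemanHorn.Theorems.AlmostPrimeZerosSystemLSDRealSegmentNairSystem
import Summits.Parity.BatemanHorn.Theorems.AlmostPrimeZerosSystemLSDRealSegmentRealForm
import HarnessLib

/-!
# Nair–Tenenbaum light, XII: `Σ_{n≤x} y^{s_f(n)} ≪ x (log x)^{k(y−1)}` — `H_x(y) = O(1)` on the real segment

Crux `SystemLSDRealSegment` (stmt-Parity-11292, route `AlmostPrimeZeros`), line `beta-thinned-root-kernel`, support programme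
of the lead c8 — the APPLICATION.  For every Bateman–Horn system `f = (f₁,…,f_k)` and every real `y ≥ 1`:
`Σ_{0≤n≤x} y^{s_f(n)} ≤ C · x (log x)^{k(y−1)}` for all large `x` (`sum_pow_stat_upper_bound`, registered closed form
`sumPowStat_upper_bound`, the mirror of the landed `sumPowStat_lower_bound`), hence the crux's normalised sum
`H_x(y) = x⁻¹ e^{k(1−y) log log x} Σ_{n≤x} y^{s_f(n)}` is BOUNDED on the real segment (`normalisedSum_bounded`).  Together:
`H_x(y) ≍ 1` for every system and every real `y > 1` — the order of magnitude predicted by the crux; what the crux adds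
(and what stays open beyond `k ≤ 1 ∧ deg ≤ 1`) is the existence and the identification `Λ(y) D^{y−1} Γ(y)^{−k}` of the limit.
Proof: `nairTenenbaumLight` (file `…NairMain`) for the shifted product polynomial `F(X + n₀)`, `F = ∏ fᵢ` (positive on `ℕ_{≥1}`;
root counts `ρ_F(p) ≤ Σ deg fᵢ`, `< p`, `ρ_F(p^a) ≤ (deg F) M` from file `…NairSystem`), with the `2k`-capped weight
`G(m) = y^{Σ_{p^v ∥ m} min(v,2k)}` (multiplicative, `≤ y^{2k}` at prime powers, `= y` at primes), which dominates `y^{s_f(n)}`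
termwise (`Σᵢ min(v_p(fᵢ(n)),2) ≤ min(v_p(F(n)),2k)`), and Mertens along the system from above
(`Σ_{p≤x} ρ_f(p)/p ≤ k log log x + C`).  Everything is PROVED; no definitions.
-/

open Finset Real Polynomial Filter

namespace Summit.Parity.BatemanHorn.Cruxes.SystemLSDRealSegment.BetaThinnedRootKernel.Nair

open Literature.NumberTheory.Sieve

noncomputable section

section UpperBound

/-! ### The weight `y^{s_K}` -/

/-- `y^{s_K(m)} ≥ 0`, `= 1` at `m = 1`, multiplicative on coprime arguments, and `≤ y^K` at prime powers (`y ≥ 1`).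
[folklore] -/
theorem weightK_props {y : ℝ} (hy : 1 ≤ y) (K : ℕ) :
    (∀ n : ℕ, 0 ≤ y ^ (n.factorization.sum fun _ v => min v K)) ∧
    (y ^ ((1 : ℕ).factorization.sum fun _ v => min v K) = 1) ∧
    (∀ m n : ℕ, m.Coprime n → y ^ ((m * n).factorization.sum fun _ v => min v K) =
      y ^ (m.factorization.sum fun _ v => min v K) * y ^ (n.factorization.sum fun _ v => min v K)) ∧
    (∀ p : ℕ, p.Prime → ∀ v : ℕ, 1 ≤ v → y ^ ((p ^ v).factorization.sum fun _ w => min w K) ≤ y ^ K) := by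
  have hy0 : 0 ≤ y := by linarith
  refine ⟨fun n => pow_nonneg hy0 _, by simp, fun m n hmn => ?_, fun p hp v _ => ?_⟩
  · rcases Nat.eq_zero_or_pos m with rfl | hm
    · have : n = 1 := by simpa using hmn
      subst this; simp
    rcases Nat.eq_zero_or_pos n with rfl | hn
    · have : m = 1 := by simpa using hmn
      subst this; simp
    rw [cappedK_mul K hm.ne' hn.ne' hmn, pow_add]
  · rw [cappedK_prime_pow K hp]
    exact pow_le_pow_right₀ hy (min_le_right _ _)

/-- At a prime the weight is `y` as soon as `K ≥ 1`. [folklore] -/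
theorem weightK_prime {y : ℝ} {K : ℕ} (hK : 1 ≤ K) {p : ℕ} (hp : p.Prime) :
    y ^ (p.factorization.sum fun _ v => min v K) = y := by
  have := cappedK_prime_pow K hp 1
  rw [pow_one] at this
  rw [this, min_eq_left hK, pow_one]

/-! ### The upper bound of the predicted order -/

section System

variable {k : ℕ} {f : Fin k → ℤ[X]}

/-- `(F(n)).toNat = ∏ᵢ (fᵢ(n)).toNat` when all `fᵢ(n) ≥ 0`. [folklore] -/
theorem toNat_eval_prod {n : ℕ} (h : ∀ i, 0 ≤ (f i).eval (n : ℤ)) :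
    ((∏ i, f i).eval (n : ℤ)).toNat = ∏ i, ((f i).eval (n : ℤ)).toNat := by
  have h1 : (((∏ i, ((f i).eval (n : ℤ)).toNat : ℕ) : ℤ)) = (∏ i, f i).eval (n : ℤ) := by
    rw [eval_prod]
    push_cast
    exact Finset.prod_congr rfl fun i _ => Int.toNat_of_nonneg (h i)
  rw [← h1, Int.toNat_natCast]

/-- **Weight domination**: for `n` with all `fᵢ(n) ≥ 1`,
`y^{s_f(n)} ≤ y^{s_{2k}(F(n))}` (`y ≥ 1`, `F = ∏ fᵢ`). [folklore] -/
theorem pow_stat_le_weightK {y : ℝ} (hy : 1 ≤ y) {n : ℕ} (h : ∀ i, 1 ≤ (f i).eval (n : ℤ)) :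
    y ^ (∑ i, (((f i).eval (n : ℤ)).toNat.factorization.sum fun _ v => min v 2)) ≤
      y ^ ((((∏ i, f i).eval (n : ℤ)).toNat).factorization.sum fun _ v => min v (2 * k)) := by
  refine pow_le_pow_right₀ hy ?_
  rw [toNat_eval_prod fun i => by linarith [h i]]
  refine sum_capped_le_cappedK _ fun i => ?_
  have : 0 < ((f i).eval (n : ℤ)).toNat := by
    rw [Int.lt_toNat]; exact_mod_cast h i
  omega

/-- **The upper bound of the predicted order, UNIFORMLY in `y ∈ [1, Y]`**: for every Bateman–Horn system `f` and `Y ≥ 1`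
there are `C > 0` and `x₀` with `Σ_{0≤n≤x} y^{s_f(n)} ≤ C · x (log x)^{k(y−1)}` for all `y ∈ [1, Y]` and all `x ≥ x₀`
(Nair–Tenenbaum light for the shifted product polynomial with the `2k`-capped weights `y^{s_{2k}}`, which lie in ONE weight class
`G(p^v) ≤ Y^{2k}`; Mertens along the system from above). [folklore] -/
theorem sum_pow_stat_upper_bound_uniform (hf : IsBatemanHornSystem f) {Y : ℝ} (hY : 1 ≤ Y) :
    ∃ C : ℝ, 0 < C ∧ ∃ x₀ : ℕ, ∀ y : ℝ, 1 ≤ y → y ≤ Y → ∀ x : ℕ, x₀ ≤ x →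
      ∑ n ∈ range (x + 1), y ^ (∑ i, (((f i).eval (n : ℤ)).toNat.factorization.sum fun _ v => min v 2)) ≤
        C * ((x : ℝ) * Real.log x ^ ((k : ℝ) * (y - 1))) := by
  have hY0 : 0 ≤ Y := by linarith
  -- the archimedean factor is `≥ 1` for `x ≥ 3`, `y ≥ 1`
  have harch : ∀ y : ℝ, 1 ≤ y → ∀ x : ℕ, 3 ≤ x → (1 : ℝ) ≤ (x : ℝ) * Real.log x ^ ((k : ℝ) * (y - 1)) := by
    intro y hy x hx
    have hx3 : (3 : ℝ) ≤ x := by exact_mod_cast hx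
    have hlog : 1 ≤ Real.log x := by
      rw [Real.le_log_iff_exp_le (by linarith)]
      exact (Real.exp_one_lt_d9.le.trans (by norm_num)).trans hx3
    have h1 : (1 : ℝ) ≤ Real.log x ^ ((k : ℝ) * (y - 1)) :=
      Real.one_le_rpow hlog (mul_nonneg (Nat.cast_nonneg _) (by linarith))
    nlinarith
  rcases Nat.eq_zero_or_pos k with hk0 | hk
  · -- `k = 0`: every term is `1`
    subst hk0
    refine ⟨2, by norm_num, 3, fun y _ _ x hx => ?_⟩
    simp only [Finset.univ_eq_empty, Finset.sum_empty, pow_zero, Finset.sum_const, Finset.card_range, nsmul_eq_mul,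
      mul_one, CharP.cast_eq_zero, zero_mul, Real.rpow_zero]
    have : (3 : ℝ) ≤ x := by exact_mod_cast hx
    push_cast; linarith
  -- `k ≥ 1`
  obtain ⟨n₀, hn₀⟩ := exists_forall_two_le_eval' hf
  set F : ℤ[X] := ∏ i, f i with hF
  set Fs : ℤ[X] := F.comp (X + C (n₀ : ℤ)) with hFs
  have hdegF : F.natDegree = ∑ i, (f i).natDegree := natDegree_prod_eq hf
  set D : ℕ := ∑ i, (f i).natDegree with hDdef
  have hD1 : 1 ≤ D := by
    rw [hDdef]
    obtain ⟨i⟩ : Nonempty (Fin k) := ⟨⟨0, hk⟩⟩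
    exact Finset.sum_pos' (fun j _ => Nat.zero_le _) ⟨i, mem_univ _, hf.natDegree_pos i⟩
  have hdFs : 1 ≤ Fs.natDegree := by rw [hFs, natDegree_comp_X_add, hdegF]; exact hD1
  -- positivity of the shifted product on `ℕ`
  have hposF : ∀ m : ℕ, n₀ ≤ m → 0 < F.eval (m : ℤ) := by
    intro m hm
    rw [hF, eval_prod]
    exact Finset.prod_pos fun i _ => by linarith [hn₀ m hm i]
  have hposFs : ∀ n : ℕ, 1 ≤ n → 0 < Fs.eval (n : ℤ) := by
    intro n _
    rw [hFs, eval_comp_X_add]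
    exact hposF _ (by omega)
  -- root-count hypotheses
  have hDρ : ∀ p : ℕ, p.Prime → polyRootCountMod ![Fs] p ≤ D := fun p hp => by
    rw [hFs, polyRootCountMod_comp_X_add]; exact rootCount_prod_le_totalDegree hf hp
  have hfixρ : ∀ p : ℕ, p.Prime → polyRootCountMod ![Fs] p < p := fun p hp => by
    rw [hFs, polyRootCountMod_comp_X_add]; exact rootCount_prod_lt hf hp
  obtain ⟨M₀, hM₀, hMF⟩ := exists_rootCount_prod_prime_pow_le hf hk
  have hMρ : ∀ p : ℕ, p.Prime → ∀ a : ℕ, 1 ≤ a → polyRootCountMod ![Fs] (p ^ a) ≤ F.natDegree * M₀ := fun p hp a _ => by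
    rw [hFs, polyRootCountMod_comp_X_add]; exact hMF p hp a
  have hM1 : 1 ≤ F.natDegree * M₀ := Nat.one_le_iff_ne_zero.2 (Nat.mul_ne_zero (by rw [hdegF]; omega) (by omega))
  have hA : (1 : ℝ) ≤ Y ^ (2 * k) := one_le_pow₀ hY
  -- Nair, for the whole class `G(p^v) ≤ Y^{2k}`
  obtain ⟨Cn, hCn, hNair⟩ := nair_sum_le hdFs hposFs hDρ hD1 hfixρ hMρ hM1 hA
  -- Mertens along the system
  obtain ⟨CM, hCM⟩ := exists_sum_rootCount_div_le hf
  -- the dominating weights `Y^{s_f(n)}` before `n₀`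
  set WY : ℕ → ℝ := fun n => Y ^ (∑ i, (((f i).eval (n : ℤ)).toNat.factorization.sum fun _ v => min v 2)) with hWY
  have hWY0 : ∀ n, 0 ≤ WY n := fun n => pow_nonneg hY0 _
  set C₀ : ℝ := ∑ n ∈ range n₀, WY n + WY n₀ with hC₀
  have hC₀0 : 0 ≤ C₀ := add_nonneg (Finset.sum_nonneg fun n _ => hWY0 n) (hWY0 _)
  refine ⟨C₀ + Cn * Real.exp ((Y - 1) * |CM|) + 1, by positivity, max 3 n₀, ?_⟩
  intro y hy hyY x hx
  have hy0 : 0 ≤ y := by linarith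
  have hx3 : 3 ≤ x := le_of_max_le_left hx
  have hxn₀ : n₀ ≤ x := le_of_max_le_right hx
  have hx1 : (1 : ℝ) < x := by exact_mod_cast (show 1 < x by omega)
  have hlogx : 0 < Real.log x := Real.log_pos hx1
  set Φ : ℝ := (x : ℝ) * Real.log x ^ ((k : ℝ) * (y - 1)) with hΦ
  have hΦ1 : 1 ≤ Φ := harch y hy x hx3
  -- the weight `y^{s_{2k}}` lies in the class
  obtain ⟨hG0, hG1, hGmul, hGA⟩ := weightK_props hy (2 * k)
  have hGA' : ∀ p : ℕ, p.Prime → ∀ v : ℕ, 1 ≤ v →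
      y ^ ((p ^ v).factorization.sum fun _ w => min w (2 * k)) ≤ Y ^ (2 * k) := fun p hp v hv =>
    (hGA p hp v hv).trans (pow_le_pow_left₀ hy0 hyY _)
  have hN := hNair (fun m => y ^ (m.factorization.sum fun _ v => min v (2 * k))) hG0 hG1 hGmul hGA'
  set W : ℕ → ℝ := fun n => y ^ (∑ i, (((f i).eval (n : ℤ)).toNat.factorization.sum fun _ v => min v 2)) with hW
  have hW0 : ∀ n, 0 ≤ W n := fun n => pow_nonneg hy0 _
  have hWle : ∀ n, W n ≤ WY n := fun n => pow_le_pow_left₀ hy0 hyY _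
  -- (1) split at `n₀`
  have hsplit : ∑ n ∈ range (x + 1), W n = ∑ n ∈ range n₀, W n + ∑ n ∈ Ico n₀ (x + 1), W n := by
    rw [Finset.range_eq_Ico, Finset.range_eq_Ico]
    exact (Finset.sum_Ico_consecutive _ (Nat.zero_le _) (by omega)).symm
  -- (2) the tail, reindexed and dominated by the Nair sum
  have htail : ∑ n ∈ Ico n₀ (x + 1), W n ≤ W n₀ + ∑ m ∈ Icc 1 x, y ^ (((Fs.eval (m : ℤ)).toNat).factorization.sum fun _ v => min v (2 * k)) := by
    rw [Finset.sum_Ico_eq_sum_range]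
    calc ∑ j ∈ range (x + 1 - n₀), W (n₀ + j) ≤ ∑ j ∈ range (x + 1), W (n₀ + j) :=
          Finset.sum_le_sum_of_subset_of_nonneg (Finset.range_mono (by omega)) fun j _ _ => hW0 _
      _ = W n₀ + ∑ j ∈ range x, W (n₀ + (j + 1)) := by
          rw [Finset.sum_range_succ']; simp only [add_zero]; ring
      _ ≤ W n₀ + ∑ j ∈ range x, y ^ (((Fs.eval ((j + 1 : ℕ) : ℤ)).toNat).factorization.sum fun _ v => min v (2 * k)) := by
          refine add_le_add le_rfl (Finset.sum_le_sum fun j _ => ?_)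
          have h1 : ∀ i, 1 ≤ (f i).eval ((n₀ + (j + 1) : ℕ) : ℤ) := fun i => by linarith [hn₀ (n₀ + (j + 1)) (by omega) i]
          refine (pow_stat_le_weightK hy h1).trans (le_of_eq ?_)
          rw [hFs, eval_comp_X_add, ← hF, show j + 1 + n₀ = n₀ + (j + 1) from by omega]
      _ = W n₀ + ∑ m ∈ Icc 1 x, y ^ (((Fs.eval (m : ℤ)).toNat).factorization.sum fun _ v => min v (2 * k)) := by
          congr 1
          rw [← Finset.Ico_add_one_right_eq_Icc, Finset.sum_Ico_eq_sum_range]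
          refine Finset.sum_congr (by congr 1) fun j _ => ?_
          rw [add_comm]
  -- (3) Nair + Mertens
  have hmain : ∑ m ∈ Icc 1 x, y ^ (((Fs.eval (m : ℤ)).toNat).factorization.sum fun _ v => min v (2 * k)) ≤
      Cn * Real.exp ((Y - 1) * |CM|) * Φ := by
    have h1 := hN x (by omega)
    have h2 : ∑ p ∈ Nat.primesLE x, (y ^ (p.factorization.sum fun _ v => min v (2 * k)) - 1) *
        (polyRootCountMod ![Fs] p : ℝ) / p = (y - 1) * ∑ p ∈ Nat.primesLE x, (polyRootCountMod f p : ℝ) / p := by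
      rw [Finset.mul_sum]
      refine Finset.sum_congr rfl fun p hp => ?_
      have hpp := (Nat.mem_primesLE.1 hp).2
      rw [weightK_prime (by omega) hpp, hFs, polyRootCountMod_comp_X_add, hF, ← PolyPrimeCountBrun.polyRootCountMod_eq_single_prod]
      ring
    rw [h2] at h1
    have h3 : (y - 1) * ∑ p ∈ Nat.primesLE x, (polyRootCountMod f p : ℝ) / p ≤ (y - 1) * (k * Real.log (Real.log x)) + (Y - 1) * |CM| := by
      have h5 := mul_le_mul_of_nonneg_left (hCM x (by omega)) (show 0 ≤ y - 1 by linarith)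
      have h6 : (y - 1) * CM ≤ (Y - 1) * |CM| := by
        calc (y - 1) * CM ≤ (y - 1) * |CM| := mul_le_mul_of_nonneg_left (le_abs_self _) (by linarith)
          _ ≤ (Y - 1) * |CM| := mul_le_mul_of_nonneg_right (by linarith) (abs_nonneg _)
      nlinarith
    have h4 : Real.exp ((y - 1) * (k * Real.log (Real.log x)) + (Y - 1) * |CM|) = Real.exp ((Y - 1) * |CM|) * Real.log x ^ ((k : ℝ) * (y - 1)) := by
      rw [Real.rpow_def_of_pos hlogx, ← Real.exp_add]; ring_nf
    calc ∑ m ∈ Icc 1 x, y ^ (((Fs.eval (m : ℤ)).toNat).factorization.sum fun _ v => min v (2 * k))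
        ≤ Cn * x * Real.exp ((y - 1) * ∑ p ∈ Nat.primesLE x, (polyRootCountMod f p : ℝ) / p) := h1
      _ ≤ Cn * x * Real.exp ((y - 1) * (k * Real.log (Real.log x)) + (Y - 1) * |CM|) := by gcongr
      _ = Cn * Real.exp ((Y - 1) * |CM|) * Φ := by rw [h4, hΦ]; ring
  -- (4) assemble
  have hC₀' : ∑ n ∈ range n₀, W n + W n₀ ≤ C₀ := by
    rw [hC₀]; exact add_le_add (Finset.sum_le_sum fun n _ => hWle n) (hWle n₀)
  calc ∑ n ∈ range (x + 1), W n = ∑ n ∈ range n₀, W n + ∑ n ∈ Ico n₀ (x + 1), W n := hsplit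
    _ ≤ ∑ n ∈ range n₀, W n + (W n₀ + Cn * Real.exp ((Y - 1) * |CM|) * Φ) := by linarith [htail, hmain]
    _ ≤ C₀ + Cn * Real.exp ((Y - 1) * |CM|) * Φ := by linarith
    _ ≤ C₀ * Φ + Cn * Real.exp ((Y - 1) * |CM|) * Φ + 1 * Φ := by nlinarith
    _ = (C₀ + Cn * Real.exp ((Y - 1) * |CM|) + 1) * Φ := by ring

/-- **The upper bound of the predicted order, every Bateman–Horn system, every real `y ≥ 1`**:
`Σ_{0≤n≤x} y^{s_f(n)} ≤ C · x (log x)^{k(y−1)}` for all large `x`. With the landed lower bound `sumPowStat_lower_bound` this pins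
the ORDER OF MAGNITUDE `Σ_{n≤x} y^{s_f(n)} ≍ x (log x)^{k(y−1)}` predicted by the crux `SystemLSDRealSegment` (whose content is the
existence and identification of the constant). [folklore] -/
theorem sum_pow_stat_upper_bound (hf : IsBatemanHornSystem f) {y : ℝ} (hy : 1 ≤ y) :
    ∃ C : ℝ, 0 < C ∧ ∀ᶠ x : ℕ in atTop,
      ∑ n ∈ range (x + 1), y ^ (∑ i, (((f i).eval (n : ℤ)).toNat.factorization.sum fun _ v => min v 2)) ≤
        C * ((x : ℝ) * Real.log x ^ ((k : ℝ) * (y - 1))) := by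
  obtain ⟨C, hC, x₀, h⟩ := sum_pow_stat_upper_bound_uniform hf hy
  exact ⟨C, hC, eventually_atTop.2 ⟨x₀, fun x hx => h y hy le_rfl x hx⟩⟩

/-- **Order of magnitude on the real segment, every Bateman–Horn system, every real `y > 1`:**
`c · x (log x)^{k(y−1)} ≤ Σ_{0≤n≤x} y^{s_f(n)} ≤ C · x (log x)^{k(y−1)}` for all large `x`
(the landed `sumPowStat_lower_bound` and `sum_pow_stat_upper_bound`).  The crux `SystemLSDRealSegment` is the statement that
the ratio converges (to `Λ(y) D^{y−1} Γ(y)^{−k}` with `Λ` holomorphic, `Λ(0) = C(f)`). [folklore] -/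
theorem sum_pow_stat_order (hf : IsBatemanHornSystem f) {y : ℝ} (hy : 1 < y) :
    ∃ c C : ℝ, 0 < c ∧ 0 < C ∧ ∀ᶠ x : ℕ in atTop,
      c * ((x : ℝ) * Real.log x ^ ((k : ℝ) * (y - 1))) ≤
          ∑ n ∈ range (x + 1), y ^ (∑ i, (((f i).eval (n : ℤ)).toNat.factorization.sum fun _ v => min v 2)) ∧
        ∑ n ∈ range (x + 1), y ^ (∑ i, (((f i).eval (n : ℤ)).toNat.factorization.sum fun _ v => min v 2)) ≤
          C * ((x : ℝ) * Real.log x ^ ((k : ℝ) * (y - 1))) := by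
  obtain ⟨c, hc, hlow⟩ := sumPowStat_lower_bound k f hf y hy
  obtain ⟨C, hC, hup⟩ := sum_pow_stat_upper_bound hf hy.le
  exact ⟨c, C, hc, hC, hlow.and hup⟩

end System

/-- **Registered form** (`--supports stmt-Parity-11292`; mirror of `sumPowStat_lower_bound`): for every Bateman–Horn system
`f` and every real `y ≥ 1` there is `C > 0` with `Σ_{0≤n≤x} y^{s_f(n)} ≤ C · x (log x)^{k(y−1)}` for all large `x`.
[folklore] -/
theorem sumPowStat_upper_bound : ∀ (k : ℕ) (f : Fin k → ℤ[X]), IsBatemanHornSystem f → ∀ y : ℝ, 1 ≤ y → ∃ C : ℝ, 0 < C ∧ ∀ᶠ x : ℕ in atTop, ∑ n ∈ Finset.range (x + 1), y ^ (∑ i, (((f i).eval (n : ℤ)).toNat.factorization.sum fun _ v => min v 2)) ≤ C * ((x : ℝ) * Real.log x ^ ((k : ℝ) * (y - 1))) :=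
  fun _k _f hf _y hy => sum_pow_stat_upper_bound hf hy

/-- **`H_x(y) = O(1)` on the real segment** — the crux's normalised sum, verbatim, is bounded for every real `y ≥ 1`
and every Bateman–Horn system: `‖x⁻¹ e^{k(1−y) log log x} Σ_{0≤n≤x} y^{s_f(n)}‖ ≤ C` for all large `x`. [folklore] -/
theorem normalisedSum_bounded {k : ℕ} {f : Fin k → ℤ[X]} (hf : IsBatemanHornSystem f) {y : ℝ} (hy : 1 ≤ y) :
    ∃ C : ℝ, ∀ᶠ x : ℕ in atTop,
      ‖(x : ℂ)⁻¹ * Complex.exp ((k : ℂ) * (1 - (y : ℂ)) * (Real.log (Real.log x) : ℂ)) *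
        ∑ n ∈ Finset.range (x + 1), (y : ℂ) ^ (∑ i, (((f i).eval (n : ℤ)).toNat.factorization.sum fun _ v => min v 2))‖ ≤ C := by
  obtain ⟨C, hC, h⟩ := sum_pow_stat_upper_bound hf hy
  refine ⟨C, ?_⟩
  filter_upwards [h, eventually_ge_atTop 3] with x hx hx3
  have hx3' : (3 : ℝ) ≤ x := by exact_mod_cast hx3
  have hx0 : (0 : ℝ) < x := by linarith
  have hlogx : 0 < Real.log x := Real.log_pos (by linarith)
  set S : ℝ := ∑ n ∈ Finset.range (x + 1), y ^ (∑ i, (((f i).eval (n : ℤ)).toNat.factorization.sum fun _ v => min v 2))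
    with hS
  have hS0 : 0 ≤ S := Finset.sum_nonneg fun n _ => pow_nonneg (by linarith) _
  -- the complex expression is the real number `x⁻¹ (log x)^{k(1−y)} S`
  have hreal : (x : ℂ)⁻¹ * Complex.exp ((k : ℂ) * (1 - (y : ℂ)) * (Real.log (Real.log x) : ℂ)) *
      ∑ n ∈ Finset.range (x + 1), (y : ℂ) ^ (∑ i, (((f i).eval (n : ℤ)).toNat.factorization.sum fun _ v => min v 2)) =
      (((x : ℝ)⁻¹ * Real.exp (k * (1 - y) * Real.log (Real.log x)) * S : ℝ) : ℂ) := by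
    rw [hS]; push_cast; rfl
  rw [hreal, Complex.norm_real, Real.norm_eq_abs, abs_of_nonneg (by positivity)]
  have hpow : Real.exp (k * (1 - y) * Real.log (Real.log x)) * Real.log x ^ ((k : ℝ) * (y - 1)) = 1 := by
    rw [Real.rpow_def_of_pos hlogx, ← Real.exp_add]
    convert Real.exp_zero using 2; ring
  have hE0 : 0 < Real.exp (k * (1 - y) * Real.log (Real.log x)) := Real.exp_pos _
  calc (x : ℝ)⁻¹ * Real.exp (k * (1 - y) * Real.log (Real.log x)) * S
      ≤ (x : ℝ)⁻¹ * Real.exp (k * (1 - y) * Real.log (Real.log x)) * (C * ((x : ℝ) * Real.log x ^ ((k : ℝ) * (y - 1)))) :=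
        mul_le_mul_of_nonneg_left hx (by positivity)
    _ = C * ((x : ℝ)⁻¹ * x) * (Real.exp (k * (1 - y) * Real.log (Real.log x)) * Real.log x ^ ((k : ℝ) * (y - 1))) := by ring
    _ = C := by rw [hpow, inv_mul_cancel₀ hx0.ne']; ring

end UpperBound

end

end Summit.Parity.BatemanHorn.Cruxes.SystemLSDRealSegment.BetaThinnedRootKernel.Nair
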